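import Summits.CriticalPhenomena.Ising3DConformalLimit.Theorems.EnergyNotSigmaSquaredMoebiusLimitExistsDefs
import Mathlib.Geometry.Euclidean.Inversion.Basic
import Summits.CriticalPhenomena.Ising3DConformalLimit.Theses.EnergyNotSigmaSquared
import Summits.CriticalPhenomena.Ising3DConformalLimit.Theorems.MoebiusLimitExists.Negative.EtaExists
import Literature.Probability.LatticeModels.ConformalCovariance
import Literature.Probability.LatticeModels.HighDimPointwiseTriviality
import Literature.Probability.LatticeModels.CriticalScalingDimension
import HarnessLib

/-!
# Pinned cluster points under a limit witness — tightness of line `only-interaction-breaks-moebius`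
for the crux `MoebiusLimitExists` (item stmt-CriticalPhenomena-1344)

Deep-refute findings (refuter `drefute-stmt-CriticalPhenomena-1344`) on the checked skeleton
`Cruxes/MoebiusLimitExists/Lines/only-interaction-breaks-moebius.lean` (objects in
`Theorems/EnergyNotSigmaSquaredMoebiusLimitExistsDefs.lean`), all kernel-checked:

* (STUBS 2, 3, 4 of the line are theorems landed by the lead — `stub_pinnedTwoPoint`,
  `stub_freeClusterPointWick`, `stub_wickPowerMoebius`; this file concerns the OPEN stubs 5, 6 and
  the pinning used by all of them.)
* EXACT PINNING: `ρ_pin(δ)² ⟨σ_{[0/δ]} σ_{[e₀/δ]}⟩_{β_c} = 1` for every `δ` (`rescaled_pin_cfg01`),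
  so every cluster point has `S₂(0,e₀) = 1` (`clusterPoint_cfg01`), consistent with STUB 2.
* TIGHTNESS (pointwise): for ANY non-degenerate limit witness `(ρ, S')` the pinned zoom converges
  pointwise off the diagonals to `aⁿ S'ₙ`, `a = S'₂(0,e₀)^{-1/2}` (`rhoPin_eq`, `rescaled_pin_eq`,
  `tendsto_rescaled_pin`), hence EVERY cluster point is `aⁿ S'ₙ` there (`clusterPoint_eq`). So the
  crux implies STUB 6 strengthened (all cluster points coincide off the diagonals, `stub6_of_crux`),
  STUB 5 strengthened (a normalised cluster point with pure-power pair function is inversion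
  covariant, `stub5_of_crux`; `Δ` is forced, `delta_eq_of_clusterPoint`) and STUB 2's conclusion
  (`stub2_conclusion_of_crux`). Neither open covariance stub can be refuted short of refuting the
  crux. (Locally uniform convergence and STUB 1: `Negative/OnlyInteractionTightness.lean`.)

References: Di Francesco–Mathieu–Sénéchal 1997 §4.1 eq. (4.15), §4.3.1 eq. (4.62).
-/

noncomputable section

open Filter Topology Set Function EuclideanGeometry
open Literature.Probability.LatticeModels
open Summit.CriticalPhenomena.Ising3DConformalLimit.MoebiusLimitExistsOnlyInteraction

namespace Summit.CriticalPhenomena.Ising3DConformalLimit.PinnedClusterPoints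

/-! ### Pinning -/

/-- `⟨σ₀σ_w⟩_{β_c} > 0` on `ℤ³`. [folklore] -/
theorem criticalTwoPoint_pos3 (w : Site 3) : 0 < criticalTwoPoint 3 w := by
  by_cases hw : w = 0
  · rw [hw, criticalTwoPoint_zero']; exact one_pos
  · obtain ⟨c, C, hc, hb⟩ := criticalTwoPoint_bounds_holds (d := 3) le_rfl
    exact lt_of_lt_of_le (mul_pos hc (Real.rpow_pos_of_pos (norm_pos_iff.2 hw) _)) (hb w hw).1

/-- `ρ_pin(δ)² ⟨σ₀σ_{⌊1/δ⌋e₀}⟩ = 1` (pinning, squared). [folklore] -/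
theorem rhoPin_sq_mul (δ : ℝ) :
    rhoPin δ ^ 2 * criticalTwoPoint 3 (Pi.single 0 (⌊1 / δ⌋ : ℤ)) = 1 := by
  have hG := criticalTwoPoint_pos3 (Pi.single 0 (⌊1 / δ⌋ : ℤ))
  have h2 : rhoPin δ ^ 2 = (criticalTwoPoint 3 (Pi.single 0 (⌊1 / δ⌋ : ℤ)))⁻¹ := by
    unfold rhoPin
    rw [← Real.rpow_natCast, ← Real.rpow_mul hG.le]
    norm_num
    exact Real.rpow_neg_one _
  rw [h2]
  exact inv_mul_cancel₀ hG.ne'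

/-- `[e₀/δ] = ⌊1/δ⌋ e₀`. [folklore] -/
theorem latticeApprox_e0 (δ : ℝ) :
    latticeApprox δ (EuclideanSpace.single (0 : Fin 3) (1 : ℝ)) = Pi.single 0 (⌊1 / δ⌋ : ℤ) := by
  funext i
  rw [latticeApprox_apply, PiLp.single_apply]
  by_cases hi : i = 0
  · subst hi; simp
  · rw [if_neg hi, Pi.single_eq_of_ne hi, zero_div, Int.floor_zero]

/-- `(0, e₀)` is non-coincident. [folklore] -/
theorem cfg01_mem : (![0, EuclideanSpace.single 0 1] : Fin 2 → EuclideanSpace ℝ (Fin 3)) ∈ NonCoincident 3 2 :=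
  zero_unitVec_mem_nonCoincident one_ne_zero

/-- **Exact pinning identity**: `ρ_pin(δ)² ⟨σ_{[0/δ]} σ_{[e₀/δ]}⟩_{β_c} = 1` for EVERY `δ`. [folklore] -/
theorem rescaled_pin_cfg01 (δ : ℝ) : rescaledCorrelator (criticalCorr 3) rhoPin 2 δ (![0, EuclideanSpace.single 0 1] : Fin 2 → EuclideanSpace ℝ (Fin 3)) = 1 := by
  rw [rescaledCorrelator_apply, latticeApprox_comp_two]
  simp only [Matrix.cons_val_zero, Matrix.cons_val_one]
  rw [latticeApprox_zero, latticeApprox_e0, criticalCorr_two, rhoPin_sq_mul]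

/-- Hence EVERY cluster point of the pinned zoom has `S₂(0, e₀) = 1` (consistent with STUB 2:
`‖0 - e₀‖^{-2Δ} = 1`). [folklore] -/
theorem clusterPoint_cfg01 {S : CorrFamily 3} (hS : IsClusterPoint S) : S 2 (![0, EuclideanSpace.single 0 1] : Fin 2 → EuclideanSpace ℝ (Fin 3)) = 1 := by
  obtain ⟨u, hu, hconv⟩ := hS
  have h := (hconv 2).tendsto_at cfg01_mem
  simp_rw [rescaled_pin_cfg01] at h
  exact (tendsto_nhds_unique tendsto_const_nhds h).symm

/-- STUB 2's prediction at `(0,e₀)` is `1`. [folklore] -/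
example (Δ : ℝ) : ‖(![0, EuclideanSpace.single 0 1] : Fin 2 → EuclideanSpace ℝ (Fin 3)) 0 - (![0, EuclideanSpace.single 0 1] : Fin 2 → EuclideanSpace ℝ (Fin 3)) 1‖ ^ (-(2 * Δ)) = 1 := by
  simp

/-! ## Tightness: the crux implies the conclusions of STUBS 2, 5, 6 for every cluster point

Under a crux witness `(ρ, Δ', S')` the pinned zoom converges POINTWISE on `NonCoincident` (full filter)
to `aⁿ S'ₙ`, `a = S'₂(0,e₀)^{-1/2}`; hence every cluster point equals `aⁿ S'ₙ` off the diagonals, all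
cluster points coincide there (⊇ STUB 6, with no regularity / power-law / interaction hypothesis), a
normalised cluster point with two-point function `‖x−y‖^{-2Δ}` is inversion covariant with THAT `Δ`
(⊇ STUB 5, `Δ = Δ'` forced at the pair `(0, 2e₀)`), and the two-point function of every cluster point is
`‖x₀−x₁‖^{-2Δ'}` (STUB 2's conclusion, without item 0634). So STUBS 5, 6 cannot be refuted without
refuting the crux. -/

/-- The rescaled pair correlator at `(0,e₀)` for a general renormalisation. [folklore] -/
theorem rescaled_cfg01 (ρ : ℝ → ℝ) (δ : ℝ) :
    rescaledCorrelator (criticalCorr 3) ρ 2 δ (![0, EuclideanSpace.single 0 1] : Fin 2 → EuclideanSpace ℝ (Fin 3)) =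
      ρ δ ^ 2 * criticalTwoPoint 3 (Pi.single 0 (⌊1 / δ⌋ : ℤ)) := by
  rw [rescaledCorrelator_apply, latticeApprox_comp_two]
  simp only [Matrix.cons_val_zero, Matrix.cons_val_one]
  rw [latticeApprox_zero, latticeApprox_e0, criticalCorr_two]

/-- `ρ_pin = (ρ² G_δ)^{-1/2} · ρ` whenever `ρ(δ) > 0`: the pinned renormalisation differs from any
positive one by the factor `r(δ)^{-1/2}`, `r(δ)` = the `ρ`-rescaled pair correlator at `(0,e₀)`. [folklore] -/
theorem rhoPin_eq {ρ : ℝ → ℝ} {δ : ℝ} (hρ : 0 < ρ δ) :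
    rhoPin δ = (rescaledCorrelator (criticalCorr 3) ρ 2 δ (![0, EuclideanSpace.single 0 1] : Fin 2 → EuclideanSpace ℝ (Fin 3))) ^ (-(1 / 2 : ℝ)) * ρ δ := by
  rw [rescaled_cfg01]
  unfold rhoPin
  have hG := (criticalTwoPoint_pos3 (Pi.single 0 (⌊1 / δ⌋ : ℤ))).le
  rw [Real.mul_rpow (by positivity) hG]
  have h2 : (ρ δ ^ 2) ^ (-(1 / 2 : ℝ)) = (ρ δ)⁻¹ := by
    rw [← Real.rpow_natCast, ← Real.rpow_mul hρ.le]
    norm_num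
    rw [Real.rpow_neg_one]
  rw [h2]
  field_simp

/-- Exact factorisation of the pinned zoom through any positive renormalisation. [folklore] -/
theorem rescaled_pin_eq {ρ : ℝ → ℝ} {δ : ℝ} (hρ : 0 < ρ δ) (n : ℕ)
    (x : Fin n → EuclideanSpace ℝ (Fin 3)) :
    rescaledCorrelator (criticalCorr 3) rhoPin n δ x =
      ((rescaledCorrelator (criticalCorr 3) ρ 2 δ (![0, EuclideanSpace.single 0 1] : Fin 2 → EuclideanSpace ℝ (Fin 3))) ^ (-(1 / 2 : ℝ))) ^ n *
        rescaledCorrelator (criticalCorr 3) ρ n δ x := by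
  rw [rescaledCorrelator_apply, rescaledCorrelator_apply (n := n), rhoPin_eq hρ, mul_pow]
  ring

/-- **Pointwise convergence of the pinned zoom under a limit witness**: if `(ρ, S')` is a
non-degenerate pointwise scaling limit, the pinned zoom converges at every non-coincident `x` to
`aⁿ S'ₙ(x)`, `a = S'₂(0,e₀)^{-1/2}`. [folklore] -/
theorem tendsto_rescaled_pin {ρ : ℝ → ℝ} {S' : CorrFamily 3} (hρ : ∀ δ ∈ Set.Ioc (0:ℝ) 1, 0 < ρ δ)
    (hlim : HasPointwiseScalingLimit (criticalCorr 3) ρ S') (hnd : IsNondegenerateTwoPoint S')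
    {n : ℕ} {x : Fin n → EuclideanSpace ℝ (Fin 3)} (hx : x ∈ NonCoincident 3 n) :
    Tendsto (fun δ => rescaledCorrelator (criticalCorr 3) rhoPin n δ x) (𝓝[>] (0:ℝ))
      (𝓝 (((S' 2 (![0, EuclideanSpace.single 0 1] : Fin 2 → EuclideanSpace ℝ (Fin 3))) ^ (-(1 / 2 : ℝ))) ^ n * S' n x)) := by
  have hA : 0 < S' 2 (![0, EuclideanSpace.single 0 1] : Fin 2 → EuclideanSpace ℝ (Fin 3)) := hnd _ cfg01_mem
  have hr : Tendsto (fun δ => rescaledCorrelator (criticalCorr 3) ρ 2 δ (![0, EuclideanSpace.single 0 1] : Fin 2 → EuclideanSpace ℝ (Fin 3))) (𝓝[>] (0:ℝ))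
      (𝓝 (S' 2 (![0, EuclideanSpace.single 0 1] : Fin 2 → EuclideanSpace ℝ (Fin 3)))) := (hlim 2).tendsto_at cfg01_mem
  have hpow := (hr.rpow_const (p := -(1 / 2 : ℝ)) (Or.inl hA.ne')).pow n
  have hprod := hpow.mul ((hlim n).tendsto_at hx)
  refine hprod.congr' ?_
  filter_upwards [Ioc_mem_nhdsGT one_pos] with δ hδ
  exact (rescaled_pin_eq (hρ δ hδ) n x).symm

/-- **Every cluster point of the pinned zoom is `aⁿ S'ₙ` off the diagonals**, for ANY
non-degenerate limit witness `(ρ, S')`. [folklore] -/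
theorem clusterPoint_eq {ρ : ℝ → ℝ} {S' S : CorrFamily 3} (hρ : ∀ δ ∈ Set.Ioc (0:ℝ) 1, 0 < ρ δ)
    (hlim : HasPointwiseScalingLimit (criticalCorr 3) ρ S') (hnd : IsNondegenerateTwoPoint S')
    (hS : IsClusterPoint S) {n : ℕ} {x : Fin n → EuclideanSpace ℝ (Fin 3)}
    (hx : x ∈ NonCoincident 3 n) :
    S n x = ((S' 2 (![0, EuclideanSpace.single 0 1] : Fin 2 → EuclideanSpace ℝ (Fin 3))) ^ (-(1 / 2 : ℝ))) ^ n * S' n x := by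
  obtain ⟨u, hu, hconv⟩ := hS
  exact tendsto_nhds_unique ((hconv n).tendsto_at hx) ((tendsto_rescaled_pin hρ hlim hnd hx).comp hu)

/-- **crux ⇒ STUB 6 (strengthened)**: under the crux ALL cluster points of the pinned zoom coincide
off the diagonals — no regularity, power law or interaction hypothesis needed. [folklore] -/
theorem stub6_of_crux (h : Summit.CriticalPhenomena.Ising3DConformalLimit.Theses.EnergyNotSigmaSquared.MoebiusLimit) :
    ∀ S₁ S₂ : CorrFamily 3, IsClusterPoint S₁ → IsClusterPoint S₂ →
      ∀ n, (NonCoincident 3 n).EqOn (S₁ n) (S₂ n) := by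
  obtain ⟨ρ, Δ', S', hρ, -, hlim, hnd, -⟩ := h
  intro S₁ S₂ h₁ h₂ n x hx
  rw [clusterPoint_eq hρ hlim hnd h₁ hx, clusterPoint_eq hρ hlim hnd h₂ hx]

/-- The axis pair `(0, 2e₀) = 2 • (0, e₀)`. [folklore] -/
theorem two_smul_cfg01 :
    (fun i => (2:ℝ) • (![0, EuclideanSpace.single 0 1] : Fin 2 → EuclideanSpace ℝ (Fin 3)) i) = (![0, EuclideanSpace.single 0 2] : Fin 2 → EuclideanSpace ℝ (Fin 3)) := by
  funext i
  fin_cases i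
  · simp
  · simp only [Fin.mk_one, Matrix.cons_val_one, Matrix.cons_val_fin_one]
    ext j
    simp [PiLp.single_apply]

/-- `(0, 2e₀)` is non-coincident. [folklore] -/
theorem cfg02_mem : (![0, EuclideanSpace.single 0 2] : Fin 2 → EuclideanSpace ℝ (Fin 3)) ∈ NonCoincident 3 2 :=
  zero_unitVec_mem_nonCoincident two_ne_zero

/-- Under a scale-covariant limit witness, the `Δ` read off a cluster point's two-point function at
the pairs `(0,e₀)`, `(0,2e₀)` IS the witness's `Δ'`. [folklore] -/
theorem delta_eq_of_clusterPoint {ρ : ℝ → ℝ} {S' S : CorrFamily 3} {Δ Δ' : ℝ}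
    (hρ : ∀ δ ∈ Set.Ioc (0:ℝ) 1, 0 < ρ δ)
    (hlim : HasPointwiseScalingLimit (criticalCorr 3) ρ S') (hnd : IsNondegenerateTwoPoint S')
    (hsc : IsScaleCovariant Δ' S') (hS : IsClusterPoint S)
    (h2 : ∀ x ∈ NonCoincident 3 2, S 2 x = ‖x 0 - x 1‖ ^ (-(2 * Δ))) : Δ = Δ' := by
  have hA : 0 < S' 2 (![0, EuclideanSpace.single 0 1] : Fin 2 → EuclideanSpace ℝ (Fin 3)) := hnd _ cfg01_mem
  -- `S 2 (0,2e₀) = 2^{-2Δ'} S 2 (0,e₀)` from the witness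
  have e1 := clusterPoint_eq hρ hlim hnd hS cfg01_mem
  have e2 := clusterPoint_eq hρ hlim hnd hS cfg02_mem
  have hs := hsc 2 2 two_pos (![0, EuclideanSpace.single 0 1] : Fin 2 → EuclideanSpace ℝ (Fin 3))
  rw [two_smul_cfg01] at hs
  rw [hs] at e2
  -- `S 2 (0,e₀) = 1`, `S 2 (0,2e₀) = 2^{-2Δ}` from the power law
  have f1 := h2 _ cfg01_mem
  have f2 := h2 _ cfg02_mem
  simp only [Matrix.cons_val_zero, Matrix.cons_val_one, zero_sub, norm_neg,
    PiLp.norm_single, Real.norm_eq_abs, abs_one, Real.one_rpow, abs_two] at f1 f2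
  -- combine: 2^{-2Δ} = 2^{-2Δ'}
  have key : (2:ℝ) ^ (-(2 * Δ)) = (2:ℝ) ^ (-((2:ℕ):ℝ) * Δ') := by
    have : S 2 ![0, EuclideanSpace.single 0 2] = (2:ℝ) ^ (-((2:ℕ):ℝ) * Δ') * S 2 (![0, EuclideanSpace.single 0 1] : Fin 2 → EuclideanSpace ℝ (Fin 3)) := by
      rw [e2, e1]; ring
    rw [← f2, this, f1, mul_one]
  have hle : -(2 * Δ) ≤ -((2:ℕ):ℝ) * Δ' := (Real.rpow_le_rpow_left_iff one_lt_two).1 key.le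
  have hge : -((2:ℕ):ℝ) * Δ' ≤ -(2 * Δ) := (Real.rpow_le_rpow_left_iff one_lt_two).1 key.ge
  push_cast at hle hge
  linarith

/-- **crux ⇒ STUB 5 (strengthened)**: under the crux, a NORMALISED cluster point whose two-point
function is `‖x₀−x₁‖^{-2Δ}` is inversion covariant with weight `Δ` — no continuity, translation
invariance or interaction hypothesis needed. [folklore] -/
theorem stub5_of_crux (h : Summit.CriticalPhenomena.Ising3DConformalLimit.Theses.EnergyNotSigmaSquared.MoebiusLimit) :
    ∀ (Δ : ℝ) (S : CorrFamily 3), IsClusterPoint S → IsNormalised S →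
      (∀ x ∈ NonCoincident 3 2, S 2 x = ‖x 0 - x 1‖ ^ (-(2 * Δ))) → IsInversionCovariant Δ S := by
  obtain ⟨ρ, Δ', S', hρ, -, hlim, hnd, hmoeb⟩ := h
  intro Δ S hS hnorm h2 n x hx0
  have hΔ : Δ = Δ' := delta_eq_of_clusterPoint hρ hlim hnd hmoeb.2.1 hS h2
  have hiff : (fun i => inversion (0 : EuclideanSpace ℝ (Fin 3)) 1 (x i)) ∈ NonCoincident 3 n ↔
      x ∈ NonCoincident 3 n := by
    rw [mem_nonCoincident, mem_nonCoincident]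
    exact (inversion_injective _ one_ne_zero).of_comp_iff x
  by_cases hx : x ∈ NonCoincident 3 n
  · rw [clusterPoint_eq hρ hlim hnd hS (hiff.2 hx), clusterPoint_eq hρ hlim hnd hS hx,
      hmoeb.2.2 n x hx0, hΔ]
    ring
  · rw [hnorm n _ (mt hiff.1 hx), hnorm n x hx, mul_zero]

/-- **crux ⇒ STUB 2's conclusion (without item 0634)**: under the crux every cluster point has the
pure-power two-point function `‖x₀−x₁‖^{-2Δ'}` with the witness's `Δ'`. [folklore] -/
theorem stub2_conclusion_of_crux (h : Summit.CriticalPhenomena.Ising3DConformalLimit.Theses.EnergyNotSigmaSquared.MoebiusLimit) :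
    ∃ Δ' : ℝ, 0 < Δ' ∧ ∀ S : CorrFamily 3, IsClusterPoint S →
      ∀ x ∈ NonCoincident 3 2, S 2 x = ‖x 0 - x 1‖ ^ (-(2 * Δ')) := by
  obtain ⟨ρ, Δ', S', hρ, hΔ', hlim, hnd, hmoeb⟩ := h
  refine ⟨Δ', hΔ', fun S hS x hx => ?_⟩
  have hA : 0 < S' 2 (![0, EuclideanSpace.single 0 1] : Fin 2 → EuclideanSpace ℝ (Fin 3)) := hnd _ cfg01_mem
  have hne : x 0 ≠ x 1 := fun h01 => by
    have := (mem_nonCoincident x).1 hx h01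
    exact absurd this (by decide)
  have hy : x 1 - x 0 ≠ 0 := sub_ne_zero.2 (Ne.symm hne)
  -- translate to `(0, x₁ - x₀)`, then radial form
  have htr := hmoeb.1.1 2 (-(x 0)) x
  have hcfg : (fun i => x i + -x 0) = ![0, x 1 - x 0] := by
    funext i; fin_cases i
    · simp
    · simp [sub_eq_add_neg]
  rw [hcfg] at htr
  have hrad := Summit.CriticalPhenomena.Ising3DConformalLimit.MoebiusLimitExistsNegative.two_point_radial
    hmoeb.1.2 hmoeb.2.1 hy
  rw [clusterPoint_eq hρ hlim hnd hS hx, ← htr, hrad]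
  have ha : ((S' 2 (![0, EuclideanSpace.single 0 1] : Fin 2 → EuclideanSpace ℝ (Fin 3))) ^ (-(1 / 2 : ℝ))) ^ 2 * S' 2 (![0, EuclideanSpace.single 0 1] : Fin 2 → EuclideanSpace ℝ (Fin 3)) = 1 := by
    rw [← Real.rpow_natCast, ← Real.rpow_mul hA.le]
    norm_num
    rw [Real.rpow_neg_one, inv_mul_cancel₀ hA.ne']
  rw [norm_sub_rev]
  calc ((S' 2 (![0, EuclideanSpace.single 0 1] : Fin 2 → EuclideanSpace ℝ (Fin 3))) ^ (-(1 / 2 : ℝ))) ^ 2 * (‖x 0 - x 1‖ ^ (-(2:ℝ) * Δ') * S' 2 (![0, EuclideanSpace.single 0 1] : Fin 2 → EuclideanSpace ℝ (Fin 3)))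
      = ‖x 0 - x 1‖ ^ (-(2:ℝ) * Δ') * (((S' 2 (![0, EuclideanSpace.single 0 1] : Fin 2 → EuclideanSpace ℝ (Fin 3))) ^ (-(1 / 2 : ℝ))) ^ 2 * S' 2 (![0, EuclideanSpace.single 0 1] : Fin 2 → EuclideanSpace ℝ (Fin 3))) := by ring
    _ = ‖x 0 - x 1‖ ^ (-(2 * Δ')) := by rw [ha, mul_one]; congr 1; ring

end Summit.CriticalPhenomena.Ising3DConformalLimit.PinnedClusterPoints

end
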